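import Mathlib
import Summits.Ventures.DiscreteObjects.Mahler.CensusSearch
import Summits.Ventures.DiscreteObjects.Mahler.GraeffeIdentity
import Summits.Ventures.DiscreteObjects.Mahler.UnitMeasureFactors
import Summits.Ventures.DiscreteObjects.Mahler.SmallMeasureReciprocal
import Summits.Ventures.DiscreteObjects.Mahler.NonreciprocalMeasureBound
import Summits.Ventures.DiscreteObjects.Mahler.LowDegreeCensus

/-!
# Certificates for the survivors of the kernel census search (venture `DiscreteObjects`, target L)

Cell `pub-namedobj`, seat `pub-namedobj-mahler-g12`. Framing: lottery ticket; floor = certified bounds/negative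
ranges.

Every half vector produced by `censusSearch` (a monic palindromic `P` of degree `n = 2d` passing the power-sum
tests) is discharged by one of four CERTIFICATES, checked by the kernel in exact integer arithmetic:

* `Cert.cyc m r`: `P · r = x^m - 1`, hence `M(P) = 1` (`intMahlerMeasure_eq_one_of_mul_eq_X_pow_sub_one`);
* `Cert.red f g`: `P = f · g` with `deg f, deg g ≥ 1`, hence `P` is reducible;
* `Cert.grf m k`: after `m` verified Graeffe root-squaring steps the `k`-th coefficient violates Mahler's bound
  `C(n,k) · B^(2^m)`, hence `B < M(P)` (`lt_intMahlerMeasure_of_graeffeChain`, mahler g2/g3);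
* `Cert.exc i s`: `P` is entry `i` of the exception list `L` (or that entry in `-x`).

`census_verdict`: if every survivor carries a valid certificate (from `allCertified … = true` by `decide`, possibly
in chunks, via `exists_cert_of_allCertified`) then every
IRREDUCIBLE monic palindromic `p` of degree `2d` with `1 < M(p) < B = Bn/Bd` is `ofCoeffs l` or `(ofCoeffs l)(-x)`
for some `l ∈ L`; `degreeCensus_of_certified` turns this into `DegreeCensus (2d) B L` for `B ≤ θ₀ = 1.3247…`
(below Smyth's constant an irreducible polynomial of measure `> 1` is ± a monic palindromic one —
`reciprocal_of_measure_lt_smythTheta`, mahler g7–g10).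
-/

namespace Summit.Ventures.DiscreteObjects.Mahler

open Polynomial

/-! ## Certificates and their checker -/

/-- Certificate for one survivor of the census search. -/
inductive Cert where
  /-- `P · r = x^m - 1` (so `M(P) = 1`). -/
  | cyc (m : ℕ) (r : List ℤ)
  /-- `P = f · g` with both factors of degree `≥ 1` (so `P` is reducible). -/
  | red (f g : List ℤ)
  /-- Graeffe rejection: after `m` root-squarings coefficient `k` exceeds `C(n,k) · B^(2^m)` (so `M(P) > B`). -/
  | grf (m k : ℕ)
  /-- `P` is the `i`-th listed exception (`s = false`) or that exception in `-x` (`s = true`). -/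
  | exc (i : ℕ) (s : Bool)

/-- The even-index entries of a list (`q(x²) ↦ q`). -/
def lpEvens : List ℤ → List ℤ
  | [] => []
  | [a] => [a]
  | a :: _ :: l => a :: lpEvens l

/-- `m` verified Graeffe steps on a monic list of degree `n`: each step computes `r = q(x)q(-x)`, takes
`q' = lpEvens r` and CHECKS `q'(x²) = r`, `|q'| = n + 1`, leading entry `1`; `none` if a check fails. -/
def graeffeIter (n : ℕ) : ℕ → List ℤ → Option (List ℤ)
  | 0, q => some q
  | m + 1, q =>
    if lpEq (lpExpand2 (lpEvens (lpMul q (lpNegAlt q)))) (lpMul q (lpNegAlt q)) &&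
        ((lpEvens (lpMul q (lpNegAlt q))).length == n + 1) &&
        ((lpEvens (lpMul q (lpNegAlt q))).getD n 0 == 1) then
      graeffeIter n m (lpEvens (lpMul q (lpNegAlt q)))
    else none

/-- A list represents a polynomial of degree exactly `|l| - 1 ≥ 1` (length `≥ 2`, last entry nonzero). -/
def lpPosDegree (l : List ℤ) : Bool := (2 ≤ l.length) && (l.getD (l.length - 1) 0 != 0)

/-- Check one certificate for the ascending coefficient list `asc` (degree `n`, bound `B = Bn/Bd`, exceptions `L`). -/
def checkCert (Bn Bd n : ℕ) (L : List (List ℤ)) (asc : List ℤ) : Cert → Bool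
  | .cyc m r => (1 ≤ m) && lpEq (lpMul asc r) (lpXPowSubOne m)
  | .red f g => lpPosDegree f && lpPosDegree g && lpEq (lpMul f g) asc
  | .grf m k =>
    match graeffeIter n m asc with
    | none => false
    | some q => decide ((n.choose k : ℤ) * (Bn : ℤ) ^ (2 ^ m) < |q.getD k 0| * (Bd : ℤ) ^ (2 ^ m))
  | .exc i s =>
    (i < L.length) && (if s then lpEq asc (lpNegAlt (L.getD i [])) else lpEq asc (L.getD i []))

/-- All survivors certified, in order (`false` on a length mismatch). -/
def allCertified (Bn Bd n : ℕ) (L : List (List ℤ)) : List (List ℤ) → List Cert → Bool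
  | [], [] => true
  | a :: as, c :: cs => checkCert Bn Bd n L (1 :: palC a) c && allCertified Bn Bd n L as cs
  | _, _ => false

/-! ## Soundness of the individual certificates -/

/-- Prepending a Graeffe step to a chain. -/
theorem GraeffeChain.cons {p q r : ℤ[X]} {m : ℕ} (h1 : IsGraeffeIterate p q) (h2 : GraeffeChain q m r) :
    GraeffeChain p (m + 1) r := by
  induction h2 with
  | refl => exact GraeffeChain.step (GraeffeChain.refl p) h1
  | step hc hqr ih => exact GraeffeChain.step ih hqr

/-- `graeffeIter` produces a genuine Graeffe chain of monic polynomials of degree `n`. -/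
theorem graeffeIter_sound (n m : ℕ) : ∀ (q q' : List ℤ), graeffeIter n m q = some q' →
    (ofCoeffs q).Monic → (ofCoeffs q).natDegree = n →
    GraeffeChain (ofCoeffs q) m (ofCoeffs q') ∧ (ofCoeffs q').Monic ∧ (ofCoeffs q').natDegree = n := by
  induction m with
  | zero =>
    intro q q' h hmon hdeg
    simp only [graeffeIter, Option.some.injEq] at h
    subst h
    exact ⟨GraeffeChain.refl _, hmon, hdeg⟩
  | succ m ih =>
    intro q q' h hmon hdeg
    simp only [graeffeIter] at h
    split_ifs at h with hc
    simp only [Bool.and_eq_true, beq_iff_eq] at hc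
    obtain ⟨⟨hEq, hlen⟩, hlast⟩ := hc
    set r := lpMul q (lpNegAlt q)
    set q1 := lpEvens r
    have hmon1 := monic_ofCoeffs hlen hlast
    have hstep : IsGraeffeIterate (ofCoeffs q) (ofCoeffs q1) := by
      refine ⟨hmon1.1, by rw [hmon1.2, hdeg], Or.inl ?_⟩
      rw [← ofCoeffs_lpExpand2, ofCoeffs_eq_of_lpEq hEq, ofCoeffs_lpMul, ofCoeffs_lpNegAlt]
    obtain ⟨hchain, hmon', hdeg'⟩ := ih q1 q' h hmon1.1 hmon1.2
    exact ⟨GraeffeChain.cons hstep hchain, hmon', hdeg'⟩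

/-- A list with `lpPosDegree` represents a polynomial of positive degree (hence a non-unit of `ℤ[X]`). -/
theorem natDegree_pos_of_lpPosDegree {l : List ℤ} (h : lpPosDegree l = true) : 0 < (ofCoeffs l).natDegree := by
  simp only [lpPosDegree, Bool.and_eq_true, decide_eq_true_eq, bne_iff_ne, ne_eq] at h
  obtain ⟨hlen, hlast⟩ := h
  rw [natDegree_ofCoeffs_eq (n := l.length - 1) (by omega) hlast]
  omega

/-- **Soundness of one certificate.** For a monic `P = ofCoeffs asc` of degree `n`, a valid certificate gives:
`M(P) = 1`, or `P` reducible, or `Bn/Bd < M(P)`, or `P ∈ L ∪ L(-x)`. -/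
theorem checkCert_sound {Bn Bd n : ℕ} (hBd : 0 < Bd) {L : List (List ℤ)} {asc : List ℤ} {c : Cert}
    (h : checkCert Bn Bd n L asc c = true) (hmon : (ofCoeffs asc).Monic) (hdeg : (ofCoeffs asc).natDegree = n) :
    intMahlerMeasure (ofCoeffs asc) = 1 ∨ ¬ Irreducible (ofCoeffs asc) ∨
      ((Bn : ℝ) / Bd < intMahlerMeasure (ofCoeffs asc)) ∨
      ∃ l ∈ L, ofCoeffs asc = ofCoeffs l ∨ ofCoeffs asc = (ofCoeffs l).comp (-X) := by
  cases c with
  | cyc m r =>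
    left
    simp only [checkCert, Bool.and_eq_true, decide_eq_true_eq] at h
    obtain ⟨hm, hEq⟩ := h
    have hprod := ofCoeffs_eq_of_lpEq hEq
    rw [ofCoeffs_lpMul, ofCoeffs_lpXPowSubOne hm] at hprod
    exact intMahlerMeasure_eq_one_of_mul_eq_X_pow_sub_one hm hprod
  | red f g =>
    right; left
    simp only [checkCert, Bool.and_eq_true] at h
    obtain ⟨⟨hf, hg⟩, hEq⟩ := h
    have hprod := ofCoeffs_eq_of_lpEq hEq
    rw [ofCoeffs_lpMul] at hprod
    intro hirr
    rcases hirr.isUnit_or_isUnit hprod.symm with hu | hu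
    · have := natDegree_eq_zero_of_isUnit hu
      have := natDegree_pos_of_lpPosDegree hf; omega
    · have := natDegree_eq_zero_of_isUnit hu
      have := natDegree_pos_of_lpPosDegree hg; omega
  | grf m k =>
    right; right; left
    simp only [checkCert] at h
    split at h
    · simp at h
    · rename_i q hq
      simp only [decide_eq_true_eq] at h
      obtain ⟨hchain, _, hdeg'⟩ := graeffeIter_sound n m asc q hq hmon hdeg
      have hBd' : (0 : ℚ) < (Bd : ℚ) ^ (2 ^ m) := by positivity
      have hk : ((ofCoeffs q).natDegree.choose k : ℚ) * ((Bn : ℚ) / Bd) ^ (2 ^ m) < |((ofCoeffs q).coeff k : ℚ)| := by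
        rw [hdeg', coeff_ofCoeffs, div_pow, ← mul_div_assoc, div_lt_iff₀ hBd']
        exact_mod_cast h
      have := lt_intMahlerMeasure_of_graeffeChain hchain k hk
      simpa [Rat.cast_div] using this
  | exc i s =>
    right; right; right
    simp only [checkCert, Bool.and_eq_true, decide_eq_true_eq] at h
    obtain ⟨hi, hEq⟩ := h
    refine ⟨L.getD i [], ?_, ?_⟩
    · rw [List.getD_eq_getElem _ _ hi]; exact List.getElem_mem hi
    · cases s with
      | true => right; rw [if_pos rfl] at hEq; rw [ofCoeffs_eq_of_lpEq hEq, ofCoeffs_lpNegAlt]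
      | false => left; rw [if_neg Bool.false_ne_true] at hEq; exact ofCoeffs_eq_of_lpEq hEq

/-- `allCertified` gives a valid certificate for every survivor. -/
theorem exists_cert_of_allCertified {Bn Bd n : ℕ} {L : List (List ℤ)} :
    ∀ (S : List (List ℤ)) (C : List Cert), allCertified Bn Bd n L S C = true →
      ∀ a ∈ S, ∃ c, checkCert Bn Bd n L (1 :: palC a) c = true := by
  intro S
  induction S with
  | nil => intro C _ a ha; simp at ha
  | cons a as ih =>
    intro C h b hb
    cases C with
    | nil => simp [allCertified] at h
    | cons c cs =>
      simp only [allCertified, Bool.and_eq_true] at h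
      rcases List.mem_cons.mp hb with rfl | hb
      · exact ⟨c, h.1⟩
      · exact ih cs h.2 b hb

/-! ## The verdict -/

/-- **Census verdict for monic palindromic polynomials.** -/
theorem census_verdict {Bn Bd d : ℕ} {T : List ℕ} {L : List (List ℤ)}
    (hBd : 0 < Bd) (hd : 1 ≤ d) (hdT : d ≤ T.length) (hT : ThresholdsValid d ((Bn : ℝ) / Bd) T)
    (hcert : ∀ a ∈ censusSearch T d [], ∃ c, checkCert Bn Bd (2 * d) L (1 :: palC a) c = true)
    {p : ℤ[X]} (hmonic : p.Monic) (hdeg : p.natDegree = 2 * d)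
    (hpal : ∀ j ≤ 2 * d, p.coeff j = p.coeff (2 * d - j)) (hirr : Irreducible p)
    (h1 : 1 < intMahlerMeasure p) (hB : intMahlerMeasure p < (Bn : ℝ) / Bd) :
    ∃ l ∈ L, p = ofCoeffs l ∨ p = (ofCoeffs l).comp (-X) := by
  have hmem := take_descCoeffList_mem_censusSearch hd hmonic hdeg hpal hB hdT hT
  obtain ⟨c, hc⟩ := hcert _ hmem
  rw [palC_take_descCoeffList hd hmonic hdeg hpal] at hc
  have hp := eq_ofCoeffs_descCoeffList hmonic hdeg hpal
  have hmon' : (ofCoeffs (1 :: descCoeffList p)).Monic := by rw [← hp]; exact hmonic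
  have hdeg' : (ofCoeffs (1 :: descCoeffList p)).natDegree = 2 * d := by rw [← hp]; exact hdeg
  have hs := checkCert_sound hBd hc hmon' hdeg'
  rw [← hp] at hs
  rcases hs with h | h | h | h
  · rw [h] at h1; exact absurd h1 (lt_irrefl _)
  · exact absurd hirr h
  · exact absurd hB (not_lt.mpr h.le)
  · exact h

/-- **From the kernel check to a census row.** For `B = Bn/Bd ≤ θ₀` the verdict gives `DegreeCensus (2d) B L`. -/
theorem degreeCensus_of_certified {Bn Bd d : ℕ} {T : List ℕ} {L : List (List ℤ)}
    (hBd : 0 < Bd) (hd : 1 ≤ d) (hdT : d ≤ T.length) (hT : ThresholdsValid d ((Bn : ℝ) / Bd) T)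
    (hθ : (Bn : ℝ) / Bd ≤ smythTheta)
    (hcert : ∀ a ∈ censusSearch T d [], ∃ c, checkCert Bn Bd (2 * d) L (1 :: palC a) c = true) :
    DegreeCensus (2 * d) ((Bn : ℝ) / Bd) L := by
  intro p hdeg hirr h1 h2
  -- reciprocal and ± monic
  have hrev := (reciprocal_of_measure_lt_smythTheta hirr h1 (lt_of_lt_of_le h2 hθ)).1
  have hlc : (|p.leadingCoeff| : ℝ) ≤ intMahlerMeasure p := abs_leadingCoeff_le_intMahlerMeasure p
  have hθ2 : smythTheta < 2 := by have := smythTheta_lt; linarith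
  have hlc1 : p.leadingCoeff = 1 ∨ p.leadingCoeff = -1 := by
    have hne : p.leadingCoeff ≠ 0 := leadingCoeff_ne_zero.mpr hirr.ne_zero
    have hle : |p.leadingCoeff| ≤ 1 := by
      by_contra h
      push Not at h
      have : (2 : ℝ) ≤ (|p.leadingCoeff| : ℝ) := by
        have : (2 : ℤ) ≤ |p.leadingCoeff| := h
        exact_mod_cast this
      linarith
    rcases abs_le.mp hle with ⟨h1', h2'⟩
    omega
  obtain ⟨hmonic, hpm, hMm, hdegm, hirrm⟩ := monic_normalisation hlc1
  set q := C p.leadingCoeff * p with hq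
  have hrevq : q.reverse = q := by rw [hq, reverse_mul_of_domain, reverse_C, hrev]
  rw [hdeg] at hdegm
  have hpal := palindromic_of_reverse_eq_self q (2 * d) hdegm hrevq
  rw [← hMm] at h1 h2
  obtain ⟨l, hl, hql⟩ := census_verdict hBd hd hdT hT hcert hmonic hdegm hpal (hirrm hirr) h1 h2
  refine ⟨l, hl, ?_⟩
  rcases hlc1 with hc | hc
  · have hpq : p = q := by rw [hpm, hc, C_1, one_mul]
    rcases hql with h | h
    · exact Or.inl (hpq.trans h)
    · exact Or.inr (Or.inr (Or.inl (hpq.trans h)))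
  · have hpq : p = -q := by
      conv_lhs => rw [hpm, hc]
      simp
    rcases hql with h | h
    · exact Or.inr (Or.inl (by rw [hpq, h]))
    · exact Or.inr (Or.inr (Or.inr (by rw [hpq, h])))

/-- Empty exception list: below `B ≤ θ₀` the verdict says there is NO irreducible monic palindromic `p` of degree `2d`
with `1 < M(p) < B` (corollary of `census_verdict`, recorded for the empty-row files). -/
theorem census_verdict_nil {Bn Bd d : ℕ} {T : List ℕ}
    (hBd : 0 < Bd) (hd : 1 ≤ d) (hdT : d ≤ T.length) (hT : ThresholdsValid d ((Bn : ℝ) / Bd) T)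
    (hcert : ∀ a ∈ censusSearch T d [], ∃ c, checkCert Bn Bd (2 * d) [] (1 :: palC a) c = true)
    {p : ℤ[X]} (hmonic : p.Monic) (hdeg : p.natDegree = 2 * d)
    (hpal : ∀ j ≤ 2 * d, p.coeff j = p.coeff (2 * d - j)) (hirr : Irreducible p)
    (h1 : 1 < intMahlerMeasure p) : (Bn : ℝ) / Bd ≤ intMahlerMeasure p := by
  by_contra hB
  push Not at hB
  obtain ⟨l, hl, -⟩ := census_verdict hBd hd hdT hT hcert hmonic hdeg hpal hirr h1 hB
  simp at hl

end Summit.Ventures.DiscreteObjects.Mahler
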